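import Mathlib.Analysis.Calculus.Deriv.MeanValue
import Mathlib.Analysis.SpecialFunctions.ExpDeriv
import Mathlib.Analysis.SpecialFunctions.Log.Deriv
import Mathlib.Analysis.Complex.ExponentialBounds
import Summits.NavierStokesRegularity.NavierStokesRegularity.Theorems.PerpetualPumpAveragedTypeIBlowupLogisticClock
import Summits.NavierStokesRegularity.NavierStokesRegularity.Theorems.PerpetualPumpAveragedTypeIBlowupGateAlgebra

/-!
# Crux `PerpetualPump.AveragedTypeIBlowup` (stmt-NavierStokesRegularity-1835), line `Sketch`:
# tools for the stub `pulse`, I — barriers, damped comparison, and the a-priori envelopes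

Generic real-analysis lemmas (Mathlib + the landed `logisticClock_*`, `ivtNesting_*`,
`gateAlgebra_*`) and the first layer of the proof of the registered stub `stub_pulse` (the TRANSFER
PULSE of the forced Toda gate `b' = -b - w² + f₁`, `w' = w(b - β - 1) + f₂`,
`β' = -q⁴β + w² + f₃`, `|fᵢ| ≤ φ`), continued in `…PulseGate.lean`, `…PulseClock.lean`,
`…Pulse.lean`.

* `pulse_barrier_upper` / `pulse_barrier_lower` — a continuous function that starts below a level
  and has a negative derivative wherever it is above the level stays below it (first passage +
  sign of the derivative at a left maximum).
* `pulse_image_sub_ge` — the mean value inequality from interior derivatives, lower form.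
* `pulse_decay_le`, `pulse_decay_abs` — damped comparison `x' ≤ -K x + ψ ⇒
  x ≤ A e^{-K(s-a)} + ψ/K`, and its two-sided form for the linear mode `x' = x k + f`, `k ≤ -K`.
* `pulse_log_growth` — exponential growth `y' ≥ K y ⇒ log y(c) ≥ log y(a) + K (c - a)`.
* `pulse_log_le` — the numerical bound `log B ≤ B/10⁴ + 33/4` for `B ≥ 10⁴`.
* `pulse_alg_*` — pointwise algebra: the energy dissipation inequality, forcing products, the clock
  at ignition (`u(0) ≤ 1 - 1/(101 B)`), and `(P - R)/2 = J/(P + R) ∈ [-43/500, 33/2000]`.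
* `pulse_envelope_energy` (= registered sub-goal `stub_pulseEnvelope`) — the a-priori envelopes on
  the whole window, valid without any sign information on `w`: the energy `b² + w² + β²` stays
  `≤ (B + 1/100)²`, `β ≥ -1/50`, and `P = b + β ∈ [B - 1/50 - 1.111 B σ, B + 1/50]`.

## References

Folklore ODE comparison arguments; the gate is the Toda-type transfer step of T. Tao, *Finite time
blowup for an averaged three-dimensional Navier–Stokes equation*, J. Amer. Math. Soc. 29 (2016),
601–674, §5.4–5.5.
-/

noncomputable section

-- the summit namespace `…NavierStokesRegularity.NavierStokesRegularity…` is the tree convention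
set_option linter.dupNamespace false

open Set Filter Topology

namespace Summit.NavierStokesRegularity.NavierStokesRegularity.Theorems.PerpetualPumpAveragedTypeIBlowup

/-- **Upper barrier.** If `x` is continuous on `[a, c]`, `x a ≤ L`, and at every interior point
where `x > L` the function `x` has a negative derivative, then `x ≤ L` on `[a, c]`: at the first
passage through a level `y ∈ (L, x s)` the derivative would be both `≥ 0` (left maximum) and `< 0`.
[folklore] -/
theorem pulse_barrier_upper {x : ℝ → ℝ} {a c L : ℝ} (hx : ContinuousOn x (Icc a c))
    (ha : x a ≤ L) (hd : ∀ s ∈ Ioo a c, L < x s → ∃ x' : ℝ, HasDerivAt x x' s ∧ x' < 0) :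
    ∀ s ∈ Icc a c, x s ≤ L := by
  intro s hs
  by_contra! hLs
  obtain ⟨c', hc', hxc', hbefore⟩ := ivtNesting_exists_first_eq hs.1
    (hx.mono (Icc_subset_Icc_right hs.2)) (show x a ≤ (L + x s) / 2 by linarith)
    (show (L + x s) / 2 ≤ x s by linarith)
  have hac' : a < c' := by
    rcases hc'.1.eq_or_lt with h | h
    · rw [← h] at hxc'; linarith
    · exact h
  have hc's : c' < c := by
    rcases hc'.2.eq_or_lt with h | h
    · rw [h] at hxc'; linarith
    · exact h.trans_le hs.2
  obtain ⟨x', hx', hneg⟩ := hd c' ⟨hac', hc's⟩ (by rw [hxc']; linarith)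
  have hnonneg : 0 ≤ x' := logisticClock_deriv_nonneg_of_left_max hac' hx'
    (fun t ht => by rw [hxc']; exact (hbefore t ht).le)
  exact absurd hnonneg (not_le.2 hneg)

/-- **Lower barrier** (the upper barrier for `-x`). If `x` is continuous on `[a, c]`, `L ≤ x a`, and
at every interior point where `x < L` the function `x` has a positive derivative, then `L ≤ x` on
`[a, c]`. [folklore] -/
theorem pulse_barrier_lower {x : ℝ → ℝ} {a c L : ℝ} (hx : ContinuousOn x (Icc a c))
    (ha : L ≤ x a) (hd : ∀ s ∈ Ioo a c, x s < L → ∃ x' : ℝ, HasDerivAt x x' s ∧ 0 < x') :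
    ∀ s ∈ Icc a c, L ≤ x s := by
  have h := pulse_barrier_upper (x := fun s => -x s) (L := -L) hx.neg (by linarith)
    (fun s hs hlt => by
      obtain ⟨x', hx', hpos⟩ := hd s hs (by linarith)
      exact ⟨-x', hx'.neg, by linarith⟩)
  intro s hs
  have := h s hs
  linarith

/-- **Mean value inequality, lower form.** If `f` is continuous on `[a, b]` and has at every
interior point a derivative `≥ C`, then `C (b - a) ≤ f b - f a`. [folklore] -/
theorem pulse_image_sub_ge {f : ℝ → ℝ} {a b C : ℝ} (hab : a ≤ b)
    (hf : ContinuousOn f (Icc a b))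
    (hf' : ∀ x ∈ Ioo a b, ∃ f' : ℝ, HasDerivAt f f' x ∧ C ≤ f') :
    C * (b - a) ≤ f b - f a := by
  have h := logisticClock_image_sub_le (f := fun s => -f s) (C := -C) hab hf.neg
    (fun x hx => by
      obtain ⟨f', hf', hle⟩ := hf' x hx
      exact ⟨-f', hf'.neg, by linarith⟩)
  linarith

/-- **Damped comparison.** If `x` is continuous on `[a, c]`, `x a ≤ A` with `0 ≤ A`, and at every
interior point where `x > 0` it has a derivative `≤ -K x + ψ` (`K > 0`, `ψ ≥ 0`), then
`x s ≤ A e^{-K (s - a)} + ψ / K` on `[a, c]` (upper barrier for `x` minus the explicit solution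
`A e^{-K(s-a)} + ψ/K` of `h' = -K h + ψ`). [folklore] -/
theorem pulse_decay_le {x : ℝ → ℝ} {a c K ψ A : ℝ} (hK : 0 < K) (hψ : 0 ≤ ψ)
    (hx : ContinuousOn x (Icc a c)) (ha : x a ≤ A) (hA : 0 ≤ A)
    (hd : ∀ s ∈ Ioo a c, 0 < x s → ∃ x' : ℝ, HasDerivAt x x' s ∧ x' ≤ -(K * x s) + ψ) :
    ∀ s ∈ Icc a c, x s ≤ A * Real.exp (-(K * (s - a))) + ψ / K := by
  have hh : ∀ s : ℝ, HasDerivAt (fun s => A * Real.exp (-(K * (s - a))) + ψ / K)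
      (A * (Real.exp (-(K * (s - a))) * (-(K * 1)))) s := fun s =>
    ((((hasDerivAt_id s).sub_const a).const_mul K).neg.exp.const_mul A).add_const (ψ / K)
  have hcont : ContinuousOn (fun s => x s - (A * Real.exp (-(K * (s - a))) + ψ / K)) (Icc a c) :=
    hx.sub (Continuous.continuousOn (by fun_prop))
  have h0 : x a - (A * Real.exp (-(K * (a - a))) + ψ / K) ≤ 0 := by
    rw [sub_self, mul_zero, neg_zero, Real.exp_zero, mul_one]
    linarith [div_nonneg hψ hK.le]
  have key := pulse_barrier_upper (L := 0) hcont h0 (fun s hs hpos => by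
    have hE := Real.exp_pos (-(K * (s - a)))
    have hψK : 0 ≤ ψ / K := div_nonneg hψ hK.le
    have hxpos : 0 < x s := by nlinarith [mul_nonneg hA hE.le]
    obtain ⟨x', hx', hle⟩ := hd s hs hxpos
    refine ⟨_, hx'.sub (hh s), ?_⟩
    have hKdiv : K * (ψ / K) = ψ := mul_div_cancel₀ ψ hK.ne'
    nlinarith [mul_pos hK hpos])
  intro s hs
  linarith [key s hs]

/-- **Damped linear mode, two-sided.** If `x` is continuous on `[a, c]` and solves
`x' = x k + f` inside with `k ≤ -K < 0` and `|f| ≤ φ`, then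
`|x s| ≤ |x a| e^{-K (s - a)} + φ / K` on `[a, c]` (`pulse_decay_le` for `x` and `-x`). [folklore] -/
theorem pulse_decay_abs {x k f : ℝ → ℝ} {a c K φ : ℝ} (hK : 0 < K) (hφ : 0 ≤ φ)
    (hx : ContinuousOn x (Icc a c))
    (hd : ∀ s ∈ Ioo a c, HasDerivAt x (x s * k s + f s) s)
    (hk : ∀ s ∈ Ioo a c, k s ≤ -K) (hf : ∀ s ∈ Ioo a c, |f s| ≤ φ) :
    ∀ s ∈ Icc a c, |x s| ≤ |x a| * Real.exp (-(K * (s - a))) + φ / K := by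
  have hup := pulse_decay_le hK hφ hx (le_abs_self (x a)) (abs_nonneg _) (fun s hs hpos => by
    refine ⟨_, hd s hs, ?_⟩
    have h1 : x s * k s ≤ x s * (-K) := mul_le_mul_of_nonneg_left (hk s hs) hpos.le
    linarith [(abs_le.1 (hf s hs)).2])
  have hdn := pulse_decay_le (x := fun s => -x s) hK hφ hx.neg (neg_le_abs (x a)) (abs_nonneg _)
    (fun s hs hpos => by
      refine ⟨_, (hd s hs).neg, ?_⟩
      have h1 : -x s * k s ≤ -x s * (-K) := mul_le_mul_of_nonneg_left (hk s hs) hpos.le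
      linarith [(abs_le.1 (hf s hs)).1])
  intro s hs
  exact abs_le.2 ⟨by linarith [hdn s hs], hup s hs⟩

/-- **Exponential growth through the logarithm.** If `y > 0` is continuous on `[a, c]` and has at
every interior point a derivative `≥ K y`, then `log (y a) + K (c - a) ≤ log (y c)` (mean value
inequality for `log ∘ y`, whose derivative is `y'/y ≥ K`). [folklore] -/
theorem pulse_log_growth {y : ℝ → ℝ} {a c K : ℝ} (hac : a ≤ c) (hpos : ∀ s ∈ Icc a c, 0 < y s)
    (hy : ContinuousOn y (Icc a c))
    (hd : ∀ s ∈ Ioo a c, ∃ y' : ℝ, HasDerivAt y y' s ∧ K * y s ≤ y') :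
    Real.log (y a) + K * (c - a) ≤ Real.log (y c) := by
  have hℓ : ContinuousOn (fun s => Real.log (y s)) (Icc a c) :=
    hy.log fun s hs => (hpos s hs).ne'
  have key := pulse_image_sub_ge (C := K) hac hℓ (fun s hs => by
    obtain ⟨y', hy', hle⟩ := hd s hs
    have hys := hpos s (Ioo_subset_Icc_self hs)
    exact ⟨y' / y s, hy'.log hys.ne', by rwa [le_div_iff₀ hys]⟩)
  linarith

/-- **A numerical logarithm bound.** For `B ≥ 10⁴`: `log B ≤ B / 10⁴ + 33/4`
(`log B = log (B/10⁴) + log 10⁴`, `log x ≤ x - 1`, and `log 10⁴ = 13 log 2 + log (10⁴/2¹³) ≤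
13 · 0.6931471808 + (10⁴/8192 - 1)`). [folklore] -/
theorem pulse_log_le {B : ℝ} (hB : (10 : ℝ) ^ 4 ≤ B) : Real.log B ≤ B / 10 ^ 4 + 33 / 4 := by
  have hB0 : 0 < B := lt_of_lt_of_le (by norm_num) hB
  have h1 : Real.log B = Real.log (B / 10 ^ 4) + Real.log ((10 : ℝ) ^ 4) := by
    rw [← Real.log_mul (by positivity) (by norm_num), div_mul_cancel₀ B (by norm_num)]
  have h2 : Real.log (B / 10 ^ 4) ≤ B / 10 ^ 4 - 1 := Real.log_le_sub_one_of_pos (by positivity)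
  have h3 : Real.log ((10 : ℝ) ^ 4) = 13 * Real.log 2 + Real.log (625 / 512) := by
    have e : (10 : ℝ) ^ 4 = 2 ^ 13 * (625 / 512) := by norm_num
    rw [e, Real.log_mul (by norm_num) (by norm_num), Real.log_pow]
    push_cast
    ring
  have h4 : Real.log ((625 : ℝ) / 512) ≤ 625 / 512 - 1 :=
    Real.log_le_sub_one_of_pos (by norm_num)
  have h5 := Real.log_two_lt_d9
  rw [h1, h3]
  norm_num at h4 ⊢
  linarith


/-- `2 x f ≤ φ (x² + 1)` when `|f| ≤ φ` (from `2|x| ≤ x² + 1`). [folklore] -/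
theorem pulse_alg_two_mul_le {x f φ : ℝ} (h : |f| ≤ φ) : 2 * x * f ≤ φ * (x ^ 2 + 1) := by
  have h1 : 2 * x * f ≤ 2 * |x| * |f| := by
    rw [mul_assoc, mul_assoc, ← abs_mul]
    exact mul_le_mul_of_nonneg_left (le_abs_self _) zero_le_two
  have h2 : 2 * |x| ≤ x ^ 2 + 1 := by nlinarith [sq_nonneg (|x| - 1), sq_abs x]
  nlinarith [abs_nonneg f, abs_nonneg x, mul_le_mul_of_nonneg_right h2 (abs_nonneg f),
    mul_le_mul_of_nonneg_left h (by positivity : (0 : ℝ) ≤ x ^ 2 + 1)]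

/-- `|2 x f| ≤ 2 M φ` when `|x| ≤ M`, `|f| ≤ φ`. [folklore] -/
theorem pulse_alg_forcing {x f M φ : ℝ} (hx : |x| ≤ M) (hf : |f| ≤ φ) :
    2 * x * f ≤ 2 * M * φ ∧ -(2 * M * φ) ≤ 2 * x * f := by
  have h : |2 * x * f| ≤ 2 * M * φ := by
    rw [mul_assoc, abs_mul, abs_two, abs_mul, mul_assoc]
    exact mul_le_mul_of_nonneg_left
      (mul_le_mul hx hf (abs_nonneg f) ((abs_nonneg x).trans hx)) zero_le_two
  exact ⟨(abs_le.1 h).2, (abs_le.1 h).1⟩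

/-- **Energy dissipation of the forced gate.** For the three right-hand sides of the gate system,
`2b b' + 2w w' + 2β β' = -2(b² + w² + q⁴β²) + 2(b f₁ + w f₂ + β f₃) ≤ 3φ` when `|fᵢ| ≤ φ ≤ 2`,
`q⁴ ≥ 1`. [folklore] -/
theorem pulse_alg_energy {b w β f₁ f₂ f₃ q4 φ : ℝ} (hq : 1 ≤ q4) (hφ2 : φ ≤ 2)
    (h1 : |f₁| ≤ φ) (h2 : |f₂| ≤ φ) (h3 : |f₃| ≤ φ) :
    2 * b * (-b - w ^ 2 + f₁) + 2 * w * (w * (b - β - 1) + f₂) +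
      2 * β * (-(q4 * β) + w ^ 2 + f₃) ≤ 3 * φ := by
  have e : 2 * b * (-b - w ^ 2 + f₁) + 2 * w * (w * (b - β - 1) + f₂) +
      2 * β * (-(q4 * β) + w ^ 2 + f₃) =
      -2 * (b ^ 2 + w ^ 2 + q4 * β ^ 2) + (2 * b * f₁ + 2 * w * f₂ + 2 * β * f₃) := by ring
  rw [e]
  have hφ0 : 0 ≤ φ := (abs_nonneg _).trans h1
  nlinarith [pulse_alg_two_mul_le (x := b) h1, pulse_alg_two_mul_le (x := w) h2,
    pulse_alg_two_mul_le (x := β) h3, sq_nonneg b, sq_nonneg w, sq_nonneg β,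
    mul_le_mul_of_nonneg_right hq (sq_nonneg β),
    mul_le_mul_of_nonneg_right hφ2 (by positivity : (0:ℝ) ≤ b ^ 2 + w ^ 2 + β ^ 2)]

/-- **A-priori envelopes of the transfer pulse, I: energy, `β ≥ -1/50`, `P = b + β`.** Along the
forced gate on `[0, σ₁]`, `σ₁ ≤ 1/10`, started at `b = B ≥ 10⁴`, `w = √B/10`, `|β| ≤ 1/50`: the
energy `b² + w² + β²` stays `≤ (B + 1/100)²` (it dissipates up to `3φ`), `β ≥ -1/50` (lower
barrier), and `P ∈ [B - 1/50 - 1.111 B σ, B + 1/50]` (barrier / mean value inequality for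
`P' = -P - (q⁴-1)β + f₁ + f₃`). [folklore] -/
theorem pulse_envelope_energy (b w β f₁ f₂ f₃ : ℝ → ℝ) (B q4 φ σ₁ : ℝ)
    (hB : 10 ^ 4 ≤ B) (hq1 : 1 ≤ q4) (hq2 : q4 ≤ 111 / 100) (hφ0 : 0 ≤ φ) (hφ1 : φ ≤ 1 / 2000)
    (hσ₁ : σ₁ ≤ 1 / 10)
    (hbc : ContinuousOn b (Icc 0 σ₁)) (hwc : ContinuousOn w (Icc 0 σ₁))
    (hβc : ContinuousOn β (Icc 0 σ₁))
    (hbd : ∀ σ ∈ Ioo 0 σ₁, HasDerivAt b (-(b σ) - (w σ) ^ 2 + f₁ σ) σ)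
    (hwd : ∀ σ ∈ Ioo 0 σ₁, HasDerivAt w (w σ * (b σ - β σ - 1) + f₂ σ) σ)
    (hβd : ∀ σ ∈ Ioo 0 σ₁, HasDerivAt β (-(q4 * β σ) + (w σ) ^ 2 + f₃ σ) σ)
    (hf : ∀ σ ∈ Icc 0 σ₁, |f₁ σ| ≤ φ ∧ |f₂ σ| ≤ φ ∧ |f₃ σ| ≤ φ)
    (hb0 : b 0 = B) (hw0 : w 0 = Real.sqrt B / 10) (hβ0 : |β 0| ≤ 1 / 50) :
    ∀ σ ∈ Icc 0 σ₁,
      |b σ| ≤ B + 1 / 100 ∧ |w σ| ≤ B + 1 / 100 ∧ |β σ| ≤ B + 1 / 100 ∧ -(1 / 50) ≤ β σ ∧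
      b σ + β σ ≤ B + 1 / 50 ∧ B - 1 / 50 - 1111 / 1000 * B * σ ≤ b σ + β σ := by
  have hB0 : 0 < B := lt_of_lt_of_le (by norm_num) hB
  have hw0sq : w 0 ^ 2 = B / 100 := by
    rw [hw0, div_pow, Real.sq_sqrt hB0.le]; norm_num
  have hβ0' := abs_le.1 hβ0
  -- (1) the energy
  have hE : ∀ σ ∈ Icc 0 σ₁, b σ ^ 2 + w σ ^ 2 + β σ ^ 2 ≤ (B + 1 / 100) ^ 2 := by
    intro σ hσ
    have hcont : ContinuousOn (fun s => b s ^ 2 + w s ^ 2 + β s ^ 2) (Icc 0 σ) :=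
      (((hbc.pow 2).add (hwc.pow 2)).add (hβc.pow 2)).mono (Icc_subset_Icc_right hσ.2)
    have key := logisticClock_image_sub_le (C := 3 * φ) hσ.1 hcont (fun s hs => by
      have hs' : s ∈ Ioo 0 σ₁ := ⟨hs.1, hs.2.trans_le hσ.2⟩
      obtain ⟨h1, h2, h3⟩ := hf s (Ioo_subset_Icc_self hs')
      exact ⟨_, ((gateAlgebra_hasDerivAt_sq (hbd s hs')).add
        (gateAlgebra_hasDerivAt_sq (hwd s hs'))).add (gateAlgebra_hasDerivAt_sq (hβd s hs')),
        pulse_alg_energy hq1 (by linarith) h1 h2 h3⟩)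
    have hE0 : b 0 ^ 2 + w 0 ^ 2 + β 0 ^ 2 ≤ B ^ 2 + B / 100 + 1 / 2500 := by
      rw [hb0, hw0sq]; nlinarith
    have h3 : 3 * φ * (σ - 0) ≤ 3 / 20000 := by nlinarith [hσ.2]
    linarith
  have habs : ∀ σ ∈ Icc 0 σ₁, |b σ| ≤ B + 1 / 100 ∧ |w σ| ≤ B + 1 / 100 ∧ |β σ| ≤ B + 1 / 100 := by
    intro σ hσ
    have h := hE σ hσ
    have hB' : 0 ≤ B + 1 / 100 := by linarith
    exact ⟨abs_le_of_sq_le_sq (by nlinarith [sq_nonneg (w σ), sq_nonneg (β σ)]) hB',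
      abs_le_of_sq_le_sq (by nlinarith [sq_nonneg (b σ), sq_nonneg (β σ)]) hB',
      abs_le_of_sq_le_sq (by nlinarith [sq_nonneg (w σ), sq_nonneg (b σ)]) hB'⟩
  -- (2) the lower barrier for `β`
  have hβlo : ∀ σ ∈ Icc 0 σ₁, -(1 / 50) ≤ β σ := by
    refine pulse_barrier_lower hβc hβ0'.1 (fun s hs hlt => ⟨_, hβd s hs, ?_⟩)
    obtain ⟨-, -, h3⟩ := hf s (Ioo_subset_Icc_self hs)
    have h3' := (abs_le.1 h3).1
    have : q4 * (1 / 50) ≤ q4 * (-β s) := mul_le_mul_of_nonneg_left (by linarith) (by linarith)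
    nlinarith [sq_nonneg (w s)]
  -- (3) the upper barrier for `P = b + β`
  have hPhi : ∀ σ ∈ Icc 0 σ₁, b σ + β σ ≤ B + 1 / 50 := by
    refine pulse_barrier_upper (x := fun s => b s + β s) (hbc.add hβc)
      (show b 0 + β 0 ≤ B + 1 / 50 by linarith)
      (fun s hs (hlt : B + 1 / 50 < b s + β s) => ⟨_, (hbd s hs).add (hβd s hs), ?_⟩)
    obtain ⟨h1, -, h3⟩ := hf s (Ioo_subset_Icc_self hs)
    have h1' := (abs_le.1 h1).2
    have h3' := (abs_le.1 h3).2
    have hβs := hβlo s (Ioo_subset_Icc_self hs)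
    have : (q4 - 1) * (-β s) ≤ (q4 - 1) * (1 / 50) :=
      mul_le_mul_of_nonneg_left (by linarith) (by linarith)
    nlinarith
  -- (4) the lower bound for `P`
  have hPlo : ∀ σ ∈ Icc 0 σ₁, B - 1 / 50 - 1111 / 1000 * B * σ ≤ b σ + β σ := by
    intro σ hσ
    have key := pulse_image_sub_ge (f := fun s => b s + β s) (C := -(1111 / 1000 * B)) hσ.1
      ((hbc.add hβc).mono (Icc_subset_Icc_right hσ.2)) (fun s hs => by
        have hs' : s ∈ Ioo 0 σ₁ := ⟨hs.1, hs.2.trans_le hσ.2⟩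
        refine ⟨_, (hbd s hs').add (hβd s hs'), ?_⟩
        obtain ⟨h1, -, h3⟩ := hf s (Ioo_subset_Icc_self hs')
        have h1' := (abs_le.1 h1).1
        have h3' := (abs_le.1 h3).1
        have hβs := (abs_le.1 (habs s (Ioo_subset_Icc_self hs')).2.2).2
        have hPs := hPhi s (Ioo_subset_Icc_self hs')
        have : (q4 - 1) * β s ≤ (q4 - 1) * (B + 1 / 100) :=
          mul_le_mul_of_nonneg_left hβs (by linarith)
        nlinarith)
    simp only [hb0, sub_zero] at key
    linarith
  intro σ hσ
  obtain ⟨hb', hw', hβ'⟩ := habs σ hσ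
  exact ⟨hb', hw', hβ', hβlo σ hσ, hPhi σ hσ, hPlo σ hσ⟩

/-- **The clock at ignition.** With `R₀² = (B - β₀)² + 2·(B/100)`, `B - β₀ = u₀ R₀`, `R₀ > 0`,
`|β₀| ≤ 1/50`, `B ≥ 10⁴`: `R₀ ∈ [B - 1/50, B + 3/100]` and `u₀ ≤ 1 - 1/(101 B)`
(`1 - u₀ = (R₀ - D₀)/R₀ = (B/50)/(R₀(R₀ + D₀))`). [folklore] -/
theorem pulse_alg_u0 {B β₀ R₀ u₀ : ℝ} (hB : 10 ^ 4 ≤ B) (hβ₀ : |β₀| ≤ 1 / 50) (hR₀ : 0 < R₀)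
    (hsq : R₀ ^ 2 = (B - β₀) ^ 2 + 2 * (B / 100)) (hD : B - β₀ = u₀ * R₀) :
    B - 1 / 50 ≤ R₀ ∧ R₀ ≤ B + 3 / 100 ∧ u₀ ≤ 1 - 1 / (101 * B) := by
  have hB0 : 0 < B := lt_of_lt_of_le (by norm_num) hB
  have hβ := abs_le.1 hβ₀
  have hhi : R₀ ≤ B + 3 / 100 := by nlinarith
  have hlo : B - 1 / 50 ≤ R₀ := by nlinarith
  refine ⟨hlo, hhi, ?_⟩
  have hsum : 0 < R₀ + (B - β₀) := by linarith
  have h1 : 0 ≤ (101 * B * (R₀ - (B - β₀)) - R₀) * (R₀ + (B - β₀)) := by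
    have e : (101 * B * (R₀ - (B - β₀)) - R₀) * (R₀ + (B - β₀)) =
        101 * B * (R₀ ^ 2 - (B - β₀) ^ 2) - R₀ * (R₀ + (B - β₀)) := by ring
    rw [e, hsq]
    nlinarith [mul_le_mul hhi (show R₀ + (B - β₀) ≤ 2 * B + 1 / 20 by linarith) hsum.le
      (by linarith)]
  have h2 : R₀ ≤ 101 * B * (R₀ - (B - β₀)) := by
    by_contra! h
    nlinarith
  have h3 : u₀ * R₀ ≤ (1 - 1 / (101 * B)) * R₀ := by
    rw [← hD]
    have : R₀ / (101 * B) ≤ R₀ - (B - β₀) := by rw [div_le_iff₀ (by positivity)]; linarith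
    have e : (1 - 1 / (101 * B)) * R₀ = R₀ - R₀ / (101 * B) := by ring
    linarith
  exact le_of_mul_le_mul_right h3 hR₀

/-- **`(P - R)/2 = J/(P + R)` is small.** From `(P - R)(P + R) = 2J`, `P + R ≥ 1.878 B`,
`J ∈ [-(4B/25 + 1/50), 3B/100]`: `(P - R)/2 ∈ [-43/500, 33/2000]`. [folklore] -/
theorem pulse_alg_X {P R J B : ℝ} (hB : 10 ^ 4 ≤ B) (hPR : (P - R) * (P + R) = 2 * J)
    (hS : 1878 / 1000 * B ≤ P + R) (hJlo : -(4 * B / 25 + 1 / 50) ≤ J) (hJhi : J ≤ 3 * B / 100) :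
    -(43 / 500) ≤ (P - R) / 2 ∧ (P - R) / 2 ≤ 33 / 2000 := by
  constructor
  · by_contra! h
    nlinarith [mul_le_mul_of_nonneg_right hS (show (0:ℝ) ≤ 43 / 500 by norm_num)]
  · by_contra! h
    nlinarith [mul_le_mul_of_nonneg_right hS (show (0:ℝ) ≤ 33 / 2000 by norm_num)]

/-- **Registered sub-goal `stub_pulseEnvelope` of the stub `pulse`** (closed form of
`pulse_envelope_energy`): the a-priori envelopes of the forced gate on `[0, σ₁]`, `σ₁ ≤ 1/10`,
from `b = B ≥ 10⁴`, `w = √B/10`, `|β| ≤ 1/50`: `|b|, |w|, |β| ≤ B + 1/100`, `β ≥ -1/50`,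
`b + β ∈ [B - 1/50 - 1.111 B σ, B + 1/50]`. [folklore] -/
theorem stub_pulseEnvelope :
    ∀ (b w β f₁ f₂ f₃ : ℝ → ℝ) (B q4 φ σ₁ : ℝ),
      10 ^ 4 ≤ B → 1 ≤ q4 → q4 ≤ 111 / 100 → 0 ≤ φ → φ ≤ 1 / 2000 → σ₁ ≤ 1 / 10 →
      ContinuousOn b (Icc 0 σ₁) → ContinuousOn w (Icc 0 σ₁) → ContinuousOn β (Icc 0 σ₁) →
      (∀ σ ∈ Ioo 0 σ₁, HasDerivAt b (-(b σ) - (w σ) ^ 2 + f₁ σ) σ) →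
      (∀ σ ∈ Ioo 0 σ₁, HasDerivAt w (w σ * (b σ - β σ - 1) + f₂ σ) σ) →
      (∀ σ ∈ Ioo 0 σ₁, HasDerivAt β (-(q4 * β σ) + (w σ) ^ 2 + f₃ σ) σ) →
      (∀ σ ∈ Icc 0 σ₁, |f₁ σ| ≤ φ ∧ |f₂ σ| ≤ φ ∧ |f₃ σ| ≤ φ) →
      b 0 = B → w 0 = Real.sqrt B / 10 → |β 0| ≤ 1 / 50 →
      ∀ σ ∈ Icc 0 σ₁,
        |b σ| ≤ B + 1 / 100 ∧ |w σ| ≤ B + 1 / 100 ∧ |β σ| ≤ B + 1 / 100 ∧ -(1 / 50) ≤ β σ ∧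
        b σ + β σ ≤ B + 1 / 50 ∧ B - 1 / 50 - 1111 / 1000 * B * σ ≤ b σ + β σ :=
  pulse_envelope_energy

end Summit.NavierStokesRegularity.NavierStokesRegularity.Theorems.PerpetualPumpAveragedTypeIBlowup

end
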